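import Mathlib
import Summits.KontsevichZagierPeriods.Zeta5Search.LeadingDigitSeries
import Summits.KontsevichZagierPeriods.Zeta5Search.UniversalDigit
import Summits.KontsevichZagierPeriods.Zeta5Search.ConstantTermFloorWindow
import HarnessLib

/-!
# ζ(5) search — the class function `Φ_x` and the PARTIAL-FRACTION IDENTITY behind gen-2's residue identities

Cell `pub-zeta5` (HONEST FRAMING: systematic search; no irrationality claim unless certified), typer seat
generation 9.  Gen-2 g9's residue identities (`RhoResidueIdentities`, `Zeta5Search/UniversalDigit.lean` §2) concern the
class function `Φ_x(η) = ∏_{s ∈ x} (η − ℓ_s)^{e_s} · [(η − ℓ_c)]` (levels `ℓ_s = ⌊s/p⌋`, net exponents `e_s`, odd centre in the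
class) whose Laurent data at the pole `ℓ_q` are the `ρ_{q,σ}` (`classRho`, coefficients of gen-2's `classCofactor`).  This file sets
up `Φ_x = N/D` as polynomials over `ℚ` and proves the algebraic partial-fraction identity

* `classPF`: `X^k · N = Σ_{q pole} Σ_{σ=1}^{n_q} ρ^{(k)}_{q,σ} · (D/(X − ℓ_q)^σ)` whenever `deg(X^k N) < deg D`, with
  `ρ^{(k)}_{q,σ} = [ε^{n_q−σ}] (ℓ_q + ε)^k·classCofactor_q(ε)`;
* `classResidueSum`: comparing top coefficients, `Σ_q ρ^{(k)}_{q,1} = [deg(X^k N) = deg D − 1]` — the residue theorem for `η^k Φ_x`.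
Ingredients: the local expansion `N(ℓ_q + ε) = classCofactor_q(ε) · D_q(ℓ_q + ε)` (`binomSeries_natCast`, `binomSeries_neg` of typer
g8), divisibility of the difference by every `(X − ℓ_q)^{n_q}`, pairwise coprimality, degrees.  The three residue identities follow in
`RhoResidueIdentitiesProof.lean`.  Pure polynomial / power-series algebra over `ℚ`; nothing about irrationality.
-/

noncomputable section

open Finset Polynomial

namespace Summit.KontsevichZagierPeriods.Zeta5Search.ClusterValuation

open Summit.KontsevichZagierPeriods.Zeta5Search.DualSeries (InBox)
open Summit.KontsevichZagierPeriods.Zeta5Search.CasoratianValuation (InPolytope)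

/-! ### Levels and the polynomials `N`, `D`, `D_q` -/

/-- The level `ℓ_s = ⌊s/p⌋` of a position, as a rational number. -/
def lvl (p s : ℕ) : ℚ := ((s / p : ℕ) : ℚ)

/-- The level of the centre `b₀/2` relative to the class of `x`: `(b₀/2 − (x mod p))/p`. -/
def lvlC (b : ℕ → ℤ) (p x : ℕ) : ℚ := ((b 0 : ℚ) / 2 - ((x % p : ℕ) : ℚ)) / p

/-- The numerator of `Φ_x`: the zeros of the class, and the odd centre when it lies in the class. -/
def numPhi (b : ℕ → ℤ) (p x : ℕ) : ℚ[X] :=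
  (∏ s ∈ (classSet b p x).filter (fun s => 0 < netExp b s), (X - C (lvl p s)) ^ (netExp b s).toNat) *
    (if ¬ (2 : ℤ) ∣ b 0 ∧ CentreIn b p x then X - C (lvlC b p x) else 1)

/-- The denominator of `Φ_x`: the poles of the class. -/
def denPhi (b : ℕ → ℤ) (p x : ℕ) : ℚ[X] := ∏ s ∈ classPoles b p x, (X - C (lvl p s)) ^ (-netExp b s).toNat

/-- The denominator with the pole `q` removed. -/
def denOff (b : ℕ → ℤ) (p x q : ℕ) : ℚ[X] := ∏ s ∈ (classPoles b p x).erase q, (X - C (lvl p s)) ^ (-netExp b s).toNat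

/-- `Z` = degree of the numerator. -/
def degN (b : ℕ → ℤ) (p x : ℕ) : ℕ :=
  (∑ s ∈ (classSet b p x).filter (fun s => 0 < netExp b s), (netExp b s).toNat) +
    (if ¬ (2 : ℤ) ∣ b 0 ∧ CentreIn b p x then 1 else 0)

/-- `P` = degree of the denominator. -/
def degD (b : ℕ → ℤ) (p x : ℕ) : ℕ := ∑ s ∈ classPoles b p x, (-netExp b s).toNat

section Basic

variable (b : ℕ → ℤ) (p x : ℕ)

/-- `N` is monic. -/
theorem numPhi_monic : (numPhi b p x).Monic := by
  unfold numPhi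
  refine (monic_prod_of_monic _ _ fun _ _ => (monic_X_sub_C _).pow _).mul ?_
  split_ifs
  · exact monic_X_sub_C _
  · exact monic_one

/-- `deg N = Z`. -/
theorem numPhi_natDegree : (numPhi b p x).natDegree = degN b p x := by
  have hZ : (∏ s ∈ (classSet b p x).filter (fun s => 0 < netExp b s), (X - C (lvl p s)) ^ (netExp b s).toNat).Monic :=
    monic_prod_of_monic _ _ fun _ _ => (monic_X_sub_C _).pow _
  have hC : (if ¬ (2 : ℤ) ∣ b 0 ∧ CentreIn b p x then X - C (lvlC b p x) else (1 : ℚ[X])).Monic := by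
    split_ifs
    · exact monic_X_sub_C _
    · exact monic_one
  unfold numPhi degN
  rw [Monic.natDegree_mul hZ hC, natDegree_prod_of_monic _ _ fun _ _ => (monic_X_sub_C _).pow _]
  congr 1
  · exact sum_congr rfl fun s _ => by rw [natDegree_pow, natDegree_X_sub_C, mul_one]
  · split_ifs
    · exact natDegree_X_sub_C _
    · exact natDegree_one

/-- `D` is monic. -/
theorem denPhi_monic : (denPhi b p x).Monic :=
  monic_prod_of_monic _ _ fun _ _ => (monic_X_sub_C _).pow _

/-- `deg D = P`. -/
theorem denPhi_natDegree : (denPhi b p x).natDegree = degD b p x := by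
  unfold denPhi degD
  rw [natDegree_prod_of_monic _ _ fun _ _ => (monic_X_sub_C _).pow _]
  exact sum_congr rfl fun s _ => by rw [natDegree_pow, natDegree_X_sub_C, mul_one]

/-- `D_q` is monic. -/
theorem denOff_monic (q : ℕ) : (denOff b p x q).Monic :=
  monic_prod_of_monic _ _ fun _ _ => (monic_X_sub_C _).pow _

/-- `D = D_q · (X − ℓ_q)^{n_q}`. -/
theorem denPhi_eq_denOff_mul {q : ℕ} (hq : q ∈ classPoles b p x) :
    denPhi b p x = denOff b p x q * (X - C (lvl p q)) ^ (-netExp b q).toNat := by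
  unfold denPhi denOff
  rw [mul_comm, mul_prod_erase (classPoles b p x) (fun s => (X - C (lvl p s)) ^ (-netExp b s).toNat) hq]

/-- `deg D_q + n_q = P`. -/
theorem denOff_natDegree {q : ℕ} (hq : q ∈ classPoles b p x) :
    (denOff b p x q).natDegree + (-netExp b q).toNat = degD b p x := by
  have h := congrArg natDegree (denPhi_eq_denOff_mul b p x hq)
  rw [denPhi_natDegree, Monic.natDegree_mul (denOff_monic b p x q) ((monic_X_sub_C _).pow _), natDegree_pow,
    natDegree_X_sub_C, mul_one] at h
  exact h.symm

/-- **`E_x = Z − P`**: the class exponent is the degree of `Φ_x`. -/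
theorem classExp_eq_degN_sub_degD : classExp b p x = (degN b p x : ℤ) - degD b p x := by
  unfold classExp degN degD classPoles
  have hsplit : ∑ s ∈ classSet b p x, netExp b s =
      ∑ s ∈ (classSet b p x).filter (fun s => 0 < netExp b s), netExp b s +
        ∑ s ∈ (classSet b p x).filter (fun s => netExp b s < 0), netExp b s := by
    rw [← sum_filter_add_sum_filter_not (classSet b p x) (fun s => 0 < netExp b s)]
    congr 1
    rw [← sum_filter_add_sum_filter_not ((classSet b p x).filter fun s => ¬ 0 < netExp b s) (fun s => netExp b s < 0)]
    have h0 : ∑ s ∈ ((classSet b p x).filter fun s => ¬ 0 < netExp b s).filter (fun s => ¬ netExp b s < 0), netExp b s = 0 :=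
      sum_eq_zero fun s hs => by
        simp only [mem_filter] at hs; omega
    rw [h0, add_zero, filter_filter]
    refine sum_congr (filter_congr fun s _ => ⟨fun h => h.2, fun h => ⟨by omega, h⟩⟩) fun _ _ => rfl
  rw [hsplit]
  have h1 : ∑ s ∈ (classSet b p x).filter (fun s => 0 < netExp b s), ((netExp b s).toNat : ℤ) =
      ∑ s ∈ (classSet b p x).filter (fun s => 0 < netExp b s), netExp b s :=
    sum_congr rfl fun s hs => Int.toNat_of_nonneg (by have := (mem_filter.1 hs).2; omega)
  have h2 : ∑ s ∈ (classSet b p x).filter (fun s => netExp b s < 0), ((-netExp b s).toNat : ℤ) =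
      -∑ s ∈ (classSet b p x).filter (fun s => netExp b s < 0), netExp b s := by
    rw [← sum_neg_distrib]
    exact sum_congr rfl fun s hs => by rw [Int.toNat_of_nonneg (by have := (mem_filter.1 hs).2; omega)]
  simp only [Nat.cast_add, Nat.cast_sum, Nat.cast_ite, Nat.cast_one, Nat.cast_zero]
  rw [h1, h2]
  split_ifs <;> ring

end Basic

/-! ### Levels inside one class -/

/-- `(q − s)/p = ℓ_q − ℓ_s` for two points of one class. -/
theorem sub_div_eq_lvl_sub (b : ℕ → ℤ) {p x q s : ℕ} (hp : 0 < p) (hq : q ∈ classSet b p x) (hs : s ∈ classSet b p x) :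
    ((q : ℚ) - s) / p = lvl p q - lvl p s := by
  have hqr : q % p = x % p := (mem_filter.1 hq).2
  have hsr : s % p = x % p := (mem_filter.1 hs).2
  have eq := Nat.div_add_mod q p
  have es := Nat.div_add_mod s p
  have hp0 : (p : ℚ) ≠ 0 := by exact_mod_cast hp.ne'
  unfold lvl
  field_simp
  have h : (q : ℤ) - s = p * ((q / p : ℕ) : ℤ) - p * ((s / p : ℕ) : ℤ) := by
    have := congrArg (fun t : ℕ => (t : ℤ)) eq
    have := congrArg (fun t : ℕ => (t : ℤ)) es
    push_cast at *
    omega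
  have h' : (q : ℚ) - s = p * ((q / p : ℕ) : ℚ) - p * ((s / p : ℕ) : ℚ) := by exact_mod_cast h
  linarith

/-- Distinct points of one class have distinct levels. -/
theorem lvl_ne_of_ne (b : ℕ → ℤ) {p x q s : ℕ} (hp : 0 < p) (hq : q ∈ classSet b p x) (hs : s ∈ classSet b p x)
    (hne : q ≠ s) : lvl p q ≠ lvl p s := by
  intro h
  have := sub_div_eq_lvl_sub b hp hq hs
  rw [h, sub_self, div_eq_zero_iff] at this
  rcases this with h1 | h1
  · exact hne (by exact_mod_cast sub_eq_zero.1 h1)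
  · exact hp.ne' (by exact_mod_cast h1)

/-- `(q − b₀/2)/p = ℓ_q − ℓ_c`. -/
theorem centre_div_eq_lvl_sub (b : ℕ → ℤ) {p x q : ℕ} (hp : 0 < p) (hq : q ∈ classSet b p x) :
    ((q : ℚ) - (b 0 : ℚ) / 2) / p = lvl p q - lvlC b p x := by
  have hqr : q % p = x % p := (mem_filter.1 hq).2
  have eq := Nat.div_add_mod q p
  have hp0 : (p : ℚ) ≠ 0 := by exact_mod_cast hp.ne'
  unfold lvl lvlC
  rw [← hqr]
  have h' : (q : ℚ) = p * ((q / p : ℕ) : ℚ) + ((q % p : ℕ) : ℚ) := by exact_mod_cast eq.symm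
  field_simp
  linarith

/-! ### The local expansion at a pole -/

/-- A linear factor composed with the shift to `ℓ_q`, as a power series: `(X − a) ∘ (X + ℓ) = X + (ℓ − a)`. -/
theorem coe_X_sub_C_comp (a ℓ : ℚ) :
    (((X - C a).comp (X + C ℓ) : ℚ[X]) : PowerSeries ℚ) = PowerSeries.X + PowerSeries.C (ℓ - a) := by
  rw [sub_comp, X_comp, C_comp, show (X + C ℓ - C a : ℚ[X]) = X + C (ℓ - a) by rw [map_sub]; ring,
    Polynomial.coe_add, Polynomial.coe_X, Polynomial.coe_C]

/-- **The local expansion**: `N(ℓ_q + ε) = classCofactor_q(ε) · D_q(ℓ_q + ε)` for a pole `q` of the class of `x`. -/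
theorem numPhi_comp_eq (b : ℕ → ℤ) {p x q : ℕ} (hp : 0 < p) (hq : q ∈ classPoles b p x) :
    (((numPhi b p x).comp (X + C (lvl p q)) : ℚ[X]) : PowerSeries ℚ) =
      classCofactor b p q * (((denOff b p x q).comp (X + C (lvl p q)) : ℚ[X]) : PowerSeries ℚ) := by
  obtain ⟨hqC, hqpole⟩ := mem_filter.1 hq
  have hCq : classSet b p q = classSet b p x := classSet_eq_of_mem hqC
  have hcen : CentreIn b p q ↔ CentreIn b p x := centreIn_iff_of_mem hqC
  -- split the cofactor product by the sign of the exponent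
  set Cq := (classSet b p x).erase q with hCqdef
  have hsplit : ∏ s ∈ Cq, binomSeries (((q : ℚ) - s) / p) (netExp b s) =
      (∏ s ∈ Cq.filter (fun s => 0 < netExp b s), binomSeries (((q : ℚ) - s) / p) (netExp b s)) *
        ∏ s ∈ Cq.filter (fun s => netExp b s < 0), binomSeries (((q : ℚ) - s) / p) (netExp b s) := by
    rw [← prod_filter_mul_prod_filter_not Cq (fun s => 0 < netExp b s)]
    congr 1
    rw [← prod_filter_mul_prod_filter_not (Cq.filter fun s => ¬ 0 < netExp b s) (fun s => netExp b s < 0)]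
    have h1 : ∏ s ∈ (Cq.filter fun s => ¬ 0 < netExp b s).filter (fun s => ¬ netExp b s < 0),
        binomSeries (((q : ℚ) - s) / p) (netExp b s) = 1 :=
      prod_eq_one fun s hs => by
        simp only [mem_filter] at hs
        rw [show netExp b s = 0 by omega, binomSeries_zero]
    rw [h1, mul_one, filter_filter]
    exact prod_congr (filter_congr fun s _ => ⟨fun h => h.2, fun h => ⟨by omega, h⟩⟩) fun _ _ => rfl
  -- the zero part equals the composed numerator product
  have hzeros : (Cq.filter fun s => 0 < netExp b s) = (classSet b p x).filter (fun s => 0 < netExp b s) := by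
    rw [hCqdef, filter_erase, erase_eq_of_notMem]
    simp only [mem_filter, not_and]; intro _; omega
  have hpoles : (Cq.filter fun s => netExp b s < 0) = (classPoles b p x).erase q := by
    rw [hCqdef, filter_erase]; rfl
  have hZ : (∏ s ∈ Cq.filter (fun s => 0 < netExp b s), binomSeries (((q : ℚ) - s) / p) (netExp b s)) =
      (((∏ s ∈ (classSet b p x).filter (fun s => 0 < netExp b s), (X - C (lvl p s)) ^ (netExp b s).toNat).comp
        (X + C (lvl p q)) : ℚ[X]) : PowerSeries ℚ) := by
    rw [hzeros, ← coe_compRingHom_apply, map_prod, ← Polynomial.coeToPowerSeries.ringHom_apply, map_prod]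
    refine prod_congr rfl fun s hs => ?_
    obtain ⟨hsC, hse⟩ := mem_filter.1 hs
    have hsq : s ≠ q := fun h => by rw [h] at hse; omega
    have hδ : ((q : ℚ) - s) / p ≠ 0 :=
      div_ne_zero (sub_ne_zero.2 (by exact_mod_cast (Ne.symm hsq))) (by exact_mod_cast hp.ne')
    rw [Polynomial.coeToPowerSeries.ringHom_apply, coe_compRingHom_apply, pow_comp, Polynomial.coe_pow, coe_X_sub_C_comp,
      ← sub_div_eq_lvl_sub b hp hqC hsC, ← binomSeries_natCast hδ, Int.toNat_of_nonneg hse.le]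
  have hPinv : (∏ s ∈ Cq.filter (fun s => netExp b s < 0), binomSeries (((q : ℚ) - s) / p) (netExp b s)) *
      (((denOff b p x q).comp (X + C (lvl p q)) : ℚ[X]) : PowerSeries ℚ) = 1 := by
    rw [hpoles, denOff, ← coe_compRingHom_apply, map_prod, ← Polynomial.coeToPowerSeries.ringHom_apply, map_prod,
      ← prod_mul_distrib]
    refine prod_eq_one fun s hs => ?_
    obtain ⟨hsq, hs'⟩ := mem_erase.1 hs
    obtain ⟨hsC, hse⟩ := mem_filter.1 hs'
    have hδ : ((q : ℚ) - s) / p ≠ 0 :=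
      div_ne_zero (sub_ne_zero.2 (by exact_mod_cast (Ne.symm hsq))) (by exact_mod_cast hp.ne')
    obtain ⟨n, hn⟩ : ∃ n : ℕ, netExp b s = -(n : ℤ) := ⟨(-netExp b s).toNat, by rw [Int.toNat_of_nonneg (by omega)]; ring⟩
    rw [Polynomial.coeToPowerSeries.ringHom_apply, coe_compRingHom_apply, pow_comp, Polynomial.coe_pow, coe_X_sub_C_comp,
      ← sub_div_eq_lvl_sub b hp hqC hsC, hn, neg_neg, Int.toNat_natCast, binomSeries_neg hδ, PowerSeries.inv_mul_cancel]
    rw [map_pow, map_add, PowerSeries.constantCoeff_X, PowerSeries.constantCoeff_C, zero_add]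
    exact pow_ne_zero _ hδ
  -- the centre factor
  have hcenF : (if ¬ (2 : ℤ) ∣ b 0 ∧ CentreIn b p q then binomSeries (((q : ℚ) - (b 0 : ℚ) / 2) / p) 1 else 1) =
      (((if ¬ (2 : ℤ) ∣ b 0 ∧ CentreIn b p x then X - C (lvlC b p x) else (1 : ℚ[X])).comp (X + C (lvl p q)) : ℚ[X]) :
        PowerSeries ℚ) := by
    by_cases hc : ¬ (2 : ℤ) ∣ b 0 ∧ CentreIn b p x
    · have hc' : ¬ (2 : ℤ) ∣ b 0 ∧ CentreIn b p q := ⟨hc.1, hcen.2 hc.2⟩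
      have hδ : ((q : ℚ) - (b 0 : ℚ) / 2) / p ≠ 0 := by
        refine div_ne_zero (fun h => hc.1 ⟨q, ?_⟩) (by exact_mod_cast hp.ne')
        have : (2 * (q : ℚ) - (b 0 : ℚ)) = 0 := by linarith
        exact_mod_cast (show ((b 0 : ℤ) : ℚ) = 2 * (q : ℤ) by push_cast; linarith)
      rw [if_pos hc', if_pos hc, binomSeries_one hδ, coe_X_sub_C_comp, centre_div_eq_lvl_sub b hp hqC]
    · have hc' : ¬ (¬ (2 : ℤ) ∣ b 0 ∧ CentreIn b p q) := fun h => hc ⟨h.1, hcen.1 h.2⟩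
      rw [if_neg hc', if_neg hc, one_comp, Polynomial.coe_one]
  -- assemble
  unfold classCofactor
  rw [hCq, ← hCqdef, hsplit, hcenF, numPhi, mul_comp, Polynomial.coe_mul, ← hZ]
  generalize (∏ s ∈ Cq.filter (fun s => 0 < netExp b s), binomSeries (((q : ℚ) - s) / p) (netExp b s)) = Zs at *
  generalize (∏ s ∈ Cq.filter (fun s => netExp b s < 0), binomSeries (((q : ℚ) - s) / p) (netExp b s)) = Ps at *
  generalize (((if ¬ (2 : ℤ) ∣ b 0 ∧ CentreIn b p x then X - C (lvlC b p x) else (1 : ℚ[X])).comp (X + C (lvl p q)) :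
    ℚ[X]) : PowerSeries ℚ) = Ce at *
  generalize (((denOff b p x q).comp (X + C (lvl p q)) : ℚ[X]) : PowerSeries ℚ) = Dc at *
  calc Zs * Ce = Zs * Ce * (Ps * Dc) := by rw [hPinv, mul_one]
    _ = Zs * Ps * Ce * Dc := by ring

end Summit.KontsevichZagierPeriods.Zeta5Search.ClusterValuation

end
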